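import Mathlib

/-!
# SM1(b): a normalised multiplicative sequence is determined by its prime values and its prime-power recursions

Blind cell `pub-manin-gamma0`, seat p3 (generation 2).  Paper reference: `proofs/T1_lead.md` §0.4 (SM1)(b): the newform `f` of level `N` and the
newform `g` of level `N_E` supplied by Modularity have the same `a_p` for every prime `p` (M as typed), both coefficient sequences are
multiplicative with `a_1 = 1`, and both satisfy `a_{p^{r+2}} = a_p a_{p^{r+1}} − χ(p) p a_{p^r}` with the SAME `χ` (`χ(p) = 𝟙[p ∤ N] = 𝟙[p ∤ N_E]`
by SM1(a)); hence `a_n(f) = a_n(g)` for all `n ≥ 1`.  We prove the underlying elementary statement (`eq_of_prime_eq`) for sequences with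
values in any commutative ring, with an arbitrary «weight factor» `w p` in the recursion.  Only Mathlib is imported; no definitions are introduced.
-/

namespace ManinGamma
namespace HeckeRecursion

/-- **SM1(b).**  Two sequences `a, b : ℕ → R` with `a 1 = b 1 = 1`, multiplicative on coprime arguments, satisfying the same three-term
prime-power recursion `x (p^(r+2)) = x p * x (p^(r+1)) - w p * x (p^r)`, and agreeing at all primes, agree at every `n ≥ 1`. -/
theorem eq_of_prime_eq {R : Type*} [CommRing R] (a b : ℕ → R) (w : ℕ → R)
    (ha1 : a 1 = 1) (hb1 : b 1 = 1)
    (hamul : ∀ m n : ℕ, Nat.Coprime m n → a (m * n) = a m * a n)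
    (hbmul : ∀ m n : ℕ, Nat.Coprime m n → b (m * n) = b m * b n)
    (harec : ∀ p r : ℕ, p.Prime → a (p ^ (r + 2)) = a p * a (p ^ (r + 1)) - w p * a (p ^ r))
    (hbrec : ∀ p r : ℕ, p.Prime → b (p ^ (r + 2)) = b p * b (p ^ (r + 1)) - w p * b (p ^ r))
    (hprime : ∀ p : ℕ, p.Prime → a p = b p) :
    ∀ n : ℕ, 0 < n → a n = b n := by
  -- prime powers, by two-step induction on the exponent
  have hpow : ∀ p : ℕ, p.Prime → ∀ k : ℕ, a (p ^ k) = b (p ^ k) ∧ a (p ^ (k + 1)) = b (p ^ (k + 1)) := by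
    intro p hp k
    induction k with
    | zero => exact ⟨by rw [pow_zero, ha1, hb1], by rw [pow_one]; exact hprime p hp⟩
    | succ k ih =>
      refine ⟨ih.2, ?_⟩
      rw [harec p k hp, hbrec p k hp, ih.1, ih.2, hprime p hp]
  intro n
  induction n using Nat.recOnPosPrimePosCoprime with
  | zero => intro h; exact absurd h (lt_irrefl 0)
  | one => intro _; rw [ha1, hb1]
  | prime_pow p k hp hk => intro _; exact (hpow p hp k).1
  | coprime m n hm hn hmn ihm ihn =>
    intro _
    rw [hamul m n hmn, hbmul m n hmn, ihm (by omega), ihn (by omega)]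

/-- The form used in SM1: with `w p = χ p * p` for an indicator `χ` common to both sequences (`χ p = 𝟙[p ∤ N] = 𝟙[p ∤ N_E]`). -/
theorem eq_of_prime_eq' {R : Type*} [CommRing R] (a b : ℕ → R) (χ : ℕ → R)
    (ha1 : a 1 = 1) (hb1 : b 1 = 1)
    (hamul : ∀ m n : ℕ, Nat.Coprime m n → a (m * n) = a m * a n)
    (hbmul : ∀ m n : ℕ, Nat.Coprime m n → b (m * n) = b m * b n)
    (harec : ∀ p r : ℕ, p.Prime → a (p ^ (r + 2)) = a p * a (p ^ (r + 1)) - χ p * p * a (p ^ r))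
    (hbrec : ∀ p r : ℕ, p.Prime → b (p ^ (r + 2)) = b p * b (p ^ (r + 1)) - χ p * p * b (p ^ r))
    (hprime : ∀ p : ℕ, p.Prime → a p = b p) (n : ℕ) (hn : 0 < n) : a n = b n :=
  eq_of_prime_eq a b (fun p => χ p * p) ha1 hb1 hamul hbmul harec hbrec hprime n hn

/-- SM1(a), the arithmetic behind «prime supports agree»: if `a (p^2) = a p ^ 2 - χ p * p` and `a (p^2) = a p ^ 2 - χ' p * p` in a ring
where `p ≠ 0` is not a zero divisor (e.g. `ℤ`), then `χ p = χ' p`. -/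
theorem indicator_eq {R : Type*} [CommRing R] [NoZeroDivisors R] (ap ap2 χp χ'p : R) (p : R) (hp : p ≠ 0)
    (h₁ : ap2 = ap ^ 2 - χp * p) (h₂ : ap2 = ap ^ 2 - χ'p * p) : χp = χ'p := by
  have : (χp - χ'p) * p = 0 := by linear_combination h₁ - h₂
  rcases mul_eq_zero.mp this with h | h
  · exact sub_eq_zero.mp h
  · exact absurd h hp

end HeckeRecursion
end ManinGamma
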